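import Literature.AlgebraicGeometry.CossartPiltant200819.TamePrimeDescentNodes2008
import Mathlib.RingTheory.Invariant.Basic
import Mathlib.RingTheory.Adjoin.Tower
import HarnessLib

/-!
# Cossart–Piltant 2008, Lemma 9.4 proof, HAL p. 29, l. 17 / 54–55 — the ring of invariants
`R := S^G` is a local model of `V/k` and `S` is finite over it (node N1 PROVED)

[CP-I] V. Cossart, O. Piltant, *Resolution of singularities of threefolds in positive
characteristic I*, J. Algebra 320 (2008) 1051–1082, HAL running-head p. 29, proof of Lemma 9.4
(journal Lemma 9.2), l. 15–17: "let `S` be a local uniformization of `W/k` … `S` is stable by `G`,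
since any conjugate of `S` is dominated by `W`, hence equal to `S`. Let `R := S^G`. Then `R` is a
normal local model of `V/k` and `S` lies above `R`", and l. 54–55: "Let `R₁ := S₁^G`. Then `R₁` is
a normal local model of `V/k` and `S₁` lies above `R₁`."

`TamePrimeDescentNodes2008.lean` isolated what the rest of the printed proof consumes of these two
sentences as the hypothesis-only node `CP2008.InvariantRingLocalModel`: for `L/K` finite Galois,
`W` a valuation ring of `L/k` with `σW = W` for all `σ ∈ G`, and `S` a `G`-stable local model of
`W/k` (HAL p. 4, Section 3: `S = A_{m_W ∩ A}` for a finitely generated `k`-algebra `A ⊆ W` with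
`Frac A = L`), the ring `S ∩ K = S^G` is a local model of `V := W ∩ K` over `k`, and `S` is a
finite `S ∩ K`-module on generators `b₁, …, b_n ∈ S`.  This module PROVES it
(`invariantRingLocalModel`), by the argument sketched in the node's docstring:

* `exists_stable_affineModel` — the affine model `A` of `S` may be taken `G`-stable (replace a
  finite generating set by the union of its `G`-conjugates, which stays inside `S`);
* `stableSubalgebraAction` — `G` then acts on `A` by `k`-algebra automorphisms, and Mathlib's
  invariant theory (`Algebra.IsInvariant.isIntegral`: `A` is integral over `A^G`, root of
  `∏_σ (X − σa)`; `Algebra.IsIntegral.finite`; the Artin–Tate lemma `fg_of_fg_of_fg`) gives: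
  `A` is a finite `A^G`-module and `A^G` is a finitely generated `k`-algebra (E. Noether);
* `L^G = K` (`exists_algebraMap_eq_of_forall_fixed`) identifies `A^G` with
  `B := A ∩ K ⊆ V`;
* the norm `N(s) := ∏_σ σ(s)` (`prod_map_mem_range`, `valuation_prod_map_eq_one`): for `s ∈ A`
  with `W(s) = 0` one has `N(s) ∈ B`, `V(N(s)) = 0` (because `σW = W`), and
  `a/s = (a ∏_{σ ≠ 1} σ s)/N(s)`; hence `Frac B = K`, `S ∩ K = B_{m_V ∩ B}` and
  `S = Σ (S ∩ K) b_i`.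

Consequently the Roots leaf of Lemma 9.4 now rests on the single node `MonomialChartRegular`
(`tamePrimeDescentViaStableModelRoots_of_monomialChart`), and the dependency statements of
`TamePrimeDescentNodes2008.lean` are re-threaded accordingly.
-/

namespace Literature.AlgebraicGeometry.CossartPiltant200819.CP2008

open Literature.AlgebraicGeometry.Resolution IsLocalRing
open scoped Pointwise

universe u

/-! ### A `G`-stable local model has a `G`-stable affine model -/

section StableAffineModel

variable {k K L : Type u} [Field k] [Field K] [Field L] [Algebra K L] [Algebra k L]
  [Algebra k K] [IsScalarTower k K L]

/-- **HAL p. 29, l. 15–17 ("`S` is stable by `G`") made affine**: a `G`-stable local model `S` of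
`W/k` is the local ring of `W` on a `G`-STABLE finitely generated `k`-algebra `A ⊆ S` with
`Frac A = L` — take any affine model (HAL p. 4, Section 3) and adjoin the finitely many
`G`-conjugates of its generators, which lie in `S`.
[cite: CossartPiltant2008, Lemma 9.4 proof (HAL p. 29, l. 15–17)] -/
theorem exists_stable_affineModel [FiniteDimensional K L] (W : ValuationSubring L)
    {S : Subalgebra k L} (hS : IsLocalModelOf k L W S)
    (hstab : ∀ σ : L ≃ₐ[K] L, ∀ s ∈ S, σ s ∈ S) :
    ∃ A : Subalgebra k L, A.FG ∧ IsFractionRing A L ∧ A ≤ S ∧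
      (∀ σ : L ≃ₐ[K] L, ∀ a ∈ A, σ a ∈ A) ∧
      ∀ s ∈ S, ∃ a ∈ A, ∃ t ∈ A, W.valuation t = 1 ∧ s = a * t⁻¹ := by
  classical
  obtain ⟨A₀, hfg₀, hfr₀, -, hSset⟩ := hS
  have hA₀S : A₀ ≤ S := fun a ha => by
    have h : a ∈ (S : Set L) := by
      rw [hSset]
      exact ⟨a, ha, 1, A₀.one_mem, by simp, by simp⟩
    exact h
  obtain ⟨t, ht⟩ := hfg₀
  -- the union of the conjugates of the generators
  let T : Set L := ⋃ σ : L ≃ₐ[K] L, (σ : L → L) '' (t : Set L)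
  have hTfin : T.Finite := Set.finite_iUnion fun σ => (t.finite_toSet.image _)
  have htT : (t : Set L) ⊆ T := fun x hx =>
    Set.mem_iUnion.mpr ⟨1, ⟨x, hx, rfl⟩⟩
  have hTstab : ∀ σ : L ≃ₐ[K] L, (σ : L → L) '' T ⊆ T := by
    rintro σ _ ⟨x, hx, rfl⟩
    obtain ⟨τ, hxτ⟩ := Set.mem_iUnion.mp hx
    obtain ⟨y, hy, rfl⟩ := hxτ
    exact Set.mem_iUnion.mpr ⟨σ * τ, ⟨y, hy, rfl⟩⟩
  have hTS : T ⊆ (S : Set L) := by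
    intro x hx
    obtain ⟨τ, hxτ⟩ := Set.mem_iUnion.mp hx
    obtain ⟨y, hy, rfl⟩ := hxτ
    exact hstab τ y (hA₀S (by rw [← ht]; exact Algebra.subset_adjoin hy))
  let A : Subalgebra k L := Algebra.adjoin k T
  have hA₀A : A₀ ≤ A := by
    rw [← ht]
    exact Algebra.adjoin_mono htT
  have hAS : A ≤ S := Algebra.adjoin_le hTS
  have hAstab : ∀ σ : L ≃ₐ[K] L, ∀ a ∈ A, σ a ∈ A := by
    intro σ a ha
    have h : (σ.restrictScalars k : L →ₐ[k] L) a ∈ A.map (σ.restrictScalars k : L →ₐ[k] L) :=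
      Subalgebra.mem_map.mpr ⟨a, ha, rfl⟩
    rw [AlgHom.map_adjoin] at h
    exact Algebra.adjoin_mono (hTstab σ) h
  refine ⟨A, ⟨hTfin.toFinset, by rw [Set.Finite.coe_toFinset]⟩, isFractionRing_of_le hA₀A hfr₀,
    hAS, hAstab, fun s hs => ?_⟩
  have h : s ∈ (S : Set L) := hs
  rw [hSset] at h
  obtain ⟨a, ha, t', ht', hvt', rfl⟩ := h
  exact ⟨a, hA₀A ha, t', hA₀A ht', hvt', rfl⟩

end StableAffineModel

/-! ### The Galois action on a stable subalgebra, and E. Noether's finiteness -/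

section GaloisAction

variable {k K L : Type u} [Field k] [Field K] [Field L] [Algebra K L] [Algebra k L]
  (A : Subalgebra k L) (hA : ∀ σ : L ≃ₐ[K] L, ∀ a ∈ A, σ a ∈ A)

/-- The action of `G = Gal(L/K)` on a `G`-stable `k`-subalgebra `A ⊆ L` by ring automorphisms
(HAL p. 29, l. 16–17: "`S` is stable by `G` … Let `R := S^G`").
[cite: CossartPiltant2008, Lemma 9.4 proof (HAL p. 29, l. 16–17)] -/
@[reducible] def stableSubalgebraAction : MulSemiringAction (L ≃ₐ[K] L) A where
  smul σ a := ⟨σ a, hA σ a a.2⟩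
  one_smul _ := rfl
  mul_smul _ _ _ := rfl
  smul_zero σ := Subtype.ext (map_zero σ)
  smul_add σ a b := Subtype.ext (map_add σ (a : L) b)
  smul_one σ := Subtype.ext (map_one σ)
  smul_mul σ a b := Subtype.ext (map_mul σ (a : L) b)

/-- The action is the Galois action on underlying elements. [folklore] -/
private theorem coe_stableSubalgebraAction_smul (σ : L ≃ₐ[K] L) (a : A) :
    letI := stableSubalgebraAction A hA
    ((σ • a : A) : L) = σ a := rfl

/-- The Galois action on a stable `k`-subalgebra commutes with the `k`-scalars (`G` fixes
`k ⊆ K`), i.e. `G` acts by `k`-algebra automorphisms (HAL p. 29, l. 16–17, where `R := S^G` is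
taken as a `k`-algebra). [cite: CossartPiltant2008, Lemma 9.4 proof (HAL p. 29, l. 16–17)] -/
theorem smulCommClass_stableSubalgebraAction [Algebra k K] [IsScalarTower k K L] :
    letI := stableSubalgebraAction A hA
    SMulCommClass (L ≃ₐ[K] L) k A := by
  letI := stableSubalgebraAction A hA
  refine ⟨fun σ c a => Subtype.ext ?_⟩
  change σ (c • (a : L)) = c • σ (a : L)
  rw [Algebra.smul_def, Algebra.smul_def, map_mul, IsScalarTower.algebraMap_apply k K L,
    AlgEquiv.commutes]

/-- Membership in the subalgebra of invariants. [folklore] -/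
private theorem mem_fixedPoints_subalgebra_iff {G : Type u} [Group G] {B : Type u} [CommRing B]
    [Algebra k B] [MulSemiringAction G B] [SMulCommClass G k B] {x : B} :
    x ∈ FixedPoints.subalgebra k B G ↔ ∀ g : G, g • x = x := Iff.rfl

/-- **E. Noether's finiteness theorem / Artin–Tate** for a finite group `G` acting on a finitely
generated `k`-algebra `B` by `k`-algebra automorphisms: `B` is a finite `B^G`-module and `B^G` is
a finitely generated `k`-algebra (`B` is integral over `B^G`, each `b` being a root of
`∏_g (X − g b)` — Mathlib `Algebra.IsInvariant.isIntegral`; integral and of finite type is finite;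
`fg_of_fg_of_fg`).  Used at HAL p. 29, l. 17 ("`R := S^G` … is a normal local model", i.e. in
particular essentially of finite type over `k`). [folklore] -/
private theorem finite_and_fg_fixedPoints {G : Type u} [Group G] [Finite G] {B : Type u}
    [CommRing B] [Algebra k B] [MulSemiringAction G B] [SMulCommClass G k B]
    (hB : (⊤ : Subalgebra k B).FG) :
    Module.Finite (FixedPoints.subalgebra k B G) B ∧ (FixedPoints.subalgebra k B G).FG := by
  haveI : Algebra.IsInvariant (FixedPoints.subalgebra k B G) B G :=
    ⟨fun x hx => ⟨⟨x, hx⟩, rfl⟩⟩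
  haveI : Algebra.IsIntegral (FixedPoints.subalgebra k B G) B :=
    Algebra.IsInvariant.isIntegral (FixedPoints.subalgebra k B G) B G
  haveI : Algebra.FiniteType k B := ⟨hB⟩
  haveI : Algebra.FiniteType (FixedPoints.subalgebra k B G) B :=
    Algebra.FiniteType.of_restrictScalars_finiteType k _ B
  haveI hfin : Module.Finite (FixedPoints.subalgebra k B G) B := Algebra.IsIntegral.finite
  exact ⟨hfin, (Subalgebra.fg_top _).mp
    (fg_of_fg_of_fg k (FixedPoints.subalgebra k B G) B hB hfin.1 Subtype.val_injective)⟩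

end GaloisAction

/-! ### The norm `N(s) = ∏_σ σ(s)` -/

section Norm

variable {K L : Type u} [Field K] [Field L] [Algebra K L] [FiniteDimensional K L]

/-- `τ N(x) = N(x)` for `N(x) := ∏_{σ ∈ G} σ(x)`. [folklore] -/
private theorem map_prod_map_eq (τ : L ≃ₐ[K] L) (x : L) :
    τ (∏ σ : L ≃ₐ[K] L, σ x) = ∏ σ : L ≃ₐ[K] L, σ x := by
  rw [map_prod]
  exact Fintype.prod_bijective (fun σ => τ * σ) (Group.mulLeft_bijective τ)
    (fun σ => τ (σ x)) (fun ρ => ρ x) fun _ => rfl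

/-- **The norm lands in `K`** (HAL p. 29, l. 17: `R := S^G ⊆ K`): `N(x) = ∏_σ σ(x) ∈ K` for
`L/K` finite Galois. [cite: CossartPiltant2008, Lemma 9.4 proof (HAL p. 29, l. 17)] -/
theorem exists_algebraMap_eq_prod_map [IsGalois K L] (x : L) :
    ∃ ν : K, algebraMap K L ν = ∏ σ : L ≃ₐ[K] L, σ x :=
  exists_algebraMap_eq_of_forall_fixed fun τ => map_prod_map_eq τ x

/-- `N(x) = x · ∏_{σ ≠ 1} σ(x)`. [folklore] -/
private theorem prod_map_eq_mul_prod_erase [DecidableEq (L ≃ₐ[K] L)] (x : L) :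
    ∏ σ : L ≃ₐ[K] L, σ x = x * ∏ σ ∈ Finset.univ.erase (1 : L ≃ₐ[K] L), σ x := by
  rw [← Finset.mul_prod_erase Finset.univ (fun σ : L ≃ₐ[K] L => σ x) (Finset.mem_univ 1)]
  rfl

/-- `x ≠ 0 ⇒ N(x) ≠ 0`. [folklore] -/
private theorem prod_map_ne_zero {x : L} (hx : x ≠ 0) : ∏ σ : L ≃ₐ[K] L, σ x ≠ 0 :=
  Finset.prod_ne_zero_iff.mpr fun _ _ => (EmbeddingLike.map_ne_zero_iff).mpr hx

/-- **`W(s) = 0 ⇒ W(N(s)) = 0` when `σW = W` for all `σ`** (HAL p. 29, l. 16–17: the conjugates of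
`S` are all dominated by `W`; here: every `σ` preserves the units of `W`).
[cite: CossartPiltant2008, Lemma 9.4 proof (HAL p. 29, l. 16–17)] -/
theorem valuation_prod_map_eq_one (W : ValuationSubring L)
    (hfix : ∀ σ : L ≃ₐ[K] L, σ • W = W) {x : L} (hx : W.valuation x = 1) :
    W.valuation (∏ σ : L ≃ₐ[K] L, σ x) = 1 := by
  rw [map_prod]
  exact Finset.prod_eq_one fun σ _ => (valuation_map_eq_one_iff W (hfix σ) x).mpr hx

end Norm

/-! ### Node N1 proved -/

section Main

/-- **Cossart–Piltant 2008, Lemma 9.4 proof, HAL p. 29, l. 17 and l. 54–55 — "Let `R := S^G`.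
Then `R` is a normal local model of `V/k` and `S` lies above `R`", the part the proof uses,
PROVED**: node `InvariantRingLocalModel` of `TamePrimeDescentNodes2008.lean` holds.  For `L/K`
finite Galois, `W` with `σW = W` for all `σ ∈ G`, and `S` a `G`-stable local model of `W/k`:
`S ∩ K` is a local model of `V = W ∩ K` over `k` (affine model `B = A ∩ K = A^G` for a `G`-stable
affine model `A` of `S`, finitely generated by E. Noether's theorem, `Frac B = K` and
`S ∩ K = B_{m_V ∩ B}` by the norm), and `S = Σ_i (S ∩ K) b_i` for finitely many `b_i ∈ S`
(`A` is finite over `A^G`; denominators are cleared by the norm, a unit of `S ∩ K`).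
[cite: CossartPiltant2008, Lemma 9.4 proof (HAL p. 29, l. 17 and l. 54–55)] -/
theorem invariantRingLocalModel : InvariantRingLocalModel.{u} := by
  intro k K _ _ _ L _ _ _ _ hfd hGal W hfix S hS hstab
  classical
  haveI := hfd
  haveI := hGal
  -- (1) a `G`-stable affine model `A` of `S`
  obtain ⟨A, hAfg, hAfr, hAS, hAstab, hSA⟩ := exists_stable_affineModel (K := K) W hS hstab
  haveI := hAfr
  have hAW : ∀ a ∈ A, a ∈ W := fun a ha => hS.mem_of_mem (hAS ha)
  set ι : K →ₐ[k] L := IsScalarTower.toAlgHom k K L with hιdef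
  have hι : ∀ c : K, ι c = algebraMap K L c := fun c => rfl
  have hιinj : Function.Injective ι := (algebraMap K L).injective
  -- (2) the action of `G` on `A` and Noether finiteness
  letI := stableSubalgebraAction (K := K) A hAstab
  haveI := smulCommClass_stableSubalgebraAction (K := K) A hAstab
  set B' : Subalgebra k A := FixedPoints.subalgebra k A (L ≃ₐ[K] L) with hB'def
  obtain ⟨hfinB', hfgB'⟩ :=
    finite_and_fg_fixedPoints (k := k) (G := L ≃ₐ[K] L) (B := A) ((Subalgebra.fg_top A).mpr hAfg)
  haveI := hfinB'
  -- invariants of `A` are the elements of `A ∩ K`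
  have hfixK : ∀ c : B', ∃ c' : K, algebraMap K L c' = ((c : A) : L) := by
    intro c
    have hc : ∀ σ : L ≃ₐ[K] L, σ • (c : A) = c := (mem_fixedPoints_subalgebra_iff (k := k)).mp c.2
    exact exists_algebraMap_eq_of_forall_fixed fun σ => congrArg Subtype.val (hc σ)
  -- generators of `A` over `A^G`
  obtain ⟨n, b, hb⟩ := Submodule.fg_iff_exists_fin_generating_family.mp
    (Module.Finite.fg_top : (⊤ : Submodule B' A).FG)
  have hcoef : ∀ a ∈ A, ∃ c : Fin n → K, (∀ i, algebraMap K L (c i) ∈ A) ∧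
      a = ∑ i, algebraMap K L (c i) * (b i : L) := by
    intro a ha
    have hmem : (⟨a, ha⟩ : A) ∈ Submodule.span B' (Set.range b) := by
      rw [hb]; exact Submodule.mem_top
    obtain ⟨c, hc⟩ := (Submodule.mem_span_range_iff_exists_fun B').mp hmem
    choose c' hc' using fun i => hfixK (c i)
    refine ⟨c', fun i => by rw [hc' i]; exact (c i : A).2, ?_⟩
    have h := congrArg (fun z : A => (z : L)) hc
    simp only [AddSubmonoidClass.coe_finsetSum, Subalgebra.smul_def, smul_eq_mul,
      Subalgebra.coe_mul] at h
    rw [← h]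
    exact Finset.sum_congr rfl fun i _ => by rw [hc' i]
  -- (3) `B := A ∩ K`
  set B : Subalgebra k K := A.comap ι with hBdef
  have hmemB : ∀ c : K, c ∈ B ↔ algebraMap K L c ∈ A := fun c => Subalgebra.mem_comap A ι c
  have hBfg : B.FG := by
    refine B.fg_of_fg_map ι hιinj ?_
    have hmap : B.map ι = B'.map A.val := by
      ext x
      simp only [Subalgebra.mem_map]
      constructor
      · rintro ⟨c, hc, rfl⟩
        refine ⟨⟨ι c, (hmemB c).mp hc⟩, ?_, rfl⟩
        exact (mem_fixedPoints_subalgebra_iff (k := k)).mpr fun σ =>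
          Subtype.ext (by change σ (ι c) = ι c; rw [hι, AlgEquiv.commutes])
      · rintro ⟨a, ha, rfl⟩
        obtain ⟨c, hc⟩ := hfixK ⟨a, ha⟩
        exact ⟨c, (hmemB c).mpr (by rw [hc]; exact a.2), hc⟩
    rw [hmap]
    exact hfgB'.map _
  -- (4) the norm
  let N : L → L := fun x => ∏ σ : L ≃ₐ[K] L, σ x
  let N' : L → L := fun x => ∏ σ ∈ Finset.univ.erase (1 : L ≃ₐ[K] L), σ x
  have hNN' : ∀ x, N x = x * N' x := fun x => prod_map_eq_mul_prod_erase x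
  have hNA : ∀ x ∈ A, N x ∈ A := fun x hx => prod_mem fun σ _ => hAstab σ x hx
  have hN'A : ∀ x ∈ A, N' x ∈ A := fun x hx => prod_mem fun σ _ => hAstab σ x hx
  have hNK : ∀ x, ∃ ν : K, algebraMap K L ν = N x := fun x => exists_algebraMap_eq_prod_map x
  have hN0 : ∀ {x : L}, x ≠ 0 → N x ≠ 0 := fun hx => prod_map_ne_zero hx
  have hN'0 : ∀ {x : L}, x ≠ 0 → N' x ≠ 0 := fun hx =>
    Finset.prod_ne_zero_iff.mpr fun _ _ => (EmbeddingLike.map_ne_zero_iff).mpr hx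
  have hNv : ∀ {x : L}, W.valuation x = 1 → W.valuation (N x) = 1 := fun hx =>
    valuation_prod_map_eq_one W hfix hx
  -- for `t ∈ A` with `W(t) = 0`: its norm `ν ∈ B` is a unit of `V` and of `S`
  have key : ∀ t ∈ A, W.valuation t = 1 → ∃ ν : K, algebraMap K L ν = N t ∧ ν ∈ B ∧ ν ≠ 0 ∧
      (W.comap (algebraMap K L)).valuation ν = 1 ∧ (algebraMap K L ν)⁻¹ ∈ S := by
    intro t ht hvt
    have ht0 : t ≠ 0 := fun h => by rw [h, map_zero] at hvt; exact zero_ne_one hvt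
    obtain ⟨ν, hν⟩ := hNK t
    have hν0 : ν ≠ 0 := fun h => hN0 ht0 (by rw [← hν, h, map_zero])
    refine ⟨ν, hν, (hmemB ν).mpr (by rw [hν]; exact hNA t ht), hν0,
      (comap_valuation_eq_one_iff' W ν).mpr (by rw [hν]; exact hNv hvt), ?_⟩
    rw [hν]
    exact (hS.inv_mem_iff_valuation_eq_one W (hAS (hNA t ht)) (hN0 ht0)).mpr (hNv hvt)
  refine ⟨⟨B, hBfg, ?_, ?_, ?_⟩, n, fun i => (b i : L), fun i => hAS (b i).2, ?_⟩
  · -- `Frac B = K`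
    refine IsFractionRing.of_field B K fun z => ?_
    obtain ⟨a, s, hs, has⟩ := IsFractionRing.div_surjective (A := A) (ι z)
    have hs0 : (s : L) ≠ 0 := by
      intro h
      exact (mem_nonZeroDivisors_iff_ne_zero.mp hs) (Subtype.ext h)
    obtain ⟨ν, hν⟩ := hNK s
    have hν0 : ν ≠ 0 := fun h => hN0 hs0 (by rw [← hν, h, map_zero])
    have hzν : z * ν ∈ B := by
      refine (hmemB _).mpr ?_
      rw [map_mul, hν, hNN', ← hι, ← has]
      change algebraMap A L a / algebraMap A L s * ((s : L) * N' s) ∈ A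
      rw [show (algebraMap A L a : L) = a from rfl, show (algebraMap A L s : L) = s from rfl,
        div_mul_eq_mul_div, mul_comm (s : L), ← mul_assoc, mul_div_assoc, div_self hs0, mul_one]
      exact A.mul_mem a.2 (hN'A s s.2)
    refine ⟨⟨z * ν, hzν⟩, ⟨ν, (hmemB ν).mpr (by rw [hν]; exact hNA s s.2)⟩, ?_⟩
    change z = z * ν / ν
    rw [mul_div_assoc, div_self hν0, mul_one]
  · -- `B ⊆ V`
    intro c hc
    have hc' : algebraMap K L c ∈ A := (hmemB c).mp hc
    exact ValuationSubring.mem_comap.mpr (hAW _ hc')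
  · -- `S ∩ K = B_{m_V ∩ B}`
    ext c
    constructor
    · intro hc
      have hcS : ι c ∈ S := (Subalgebra.mem_comap S ι c).mp hc
      obtain ⟨a, ha, t, ht, hvt, hct⟩ := hSA (ι c) hcS
      have ht0 : t ≠ 0 := fun h => by rw [h, map_zero] at hvt; exact zero_ne_one hvt
      obtain ⟨ν, hν, hνB, hν0, hνv, -⟩ := key t ht hvt
      refine ⟨c * ν, ?_, ν, hνB, hνv, (mul_inv_cancel_right₀ hν0 c).symm⟩
      refine (hmemB _).mpr ?_
      rw [map_mul, hν, hNN' t, ← hι c, hct, mul_assoc, inv_mul_cancel_left₀ ht0]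
      exact A.mul_mem ha (hN'A t ht)
    · rintro ⟨a, ha, s, hs, hvs, rfl⟩
      have haA : ι a ∈ A := (hmemB a).mp ha
      have hsA : ι s ∈ A := (hmemB s).mp hs
      have hs1 : W.valuation (ι s) = 1 := (comap_valuation_eq_one_iff' W s).mp hvs
      have hs0 : ι s ≠ 0 := fun h => by rw [h, map_zero] at hs1; exact zero_ne_one hs1
      change a * s⁻¹ ∈ S.comap ι
      rw [Subalgebra.mem_comap, map_mul, map_inv₀]
      exact S.mul_mem (hAS haA) ((hS.inv_mem_iff_valuation_eq_one W (hAS hsA) hs0).mpr hs1)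
  · -- `S = Σ (S ∩ K) b_i`
    intro s hs
    obtain ⟨a, ha, t, ht, hvt, hst⟩ := hSA s hs
    have ht0 : t ≠ 0 := fun h => by rw [h, map_zero] at hvt; exact zero_ne_one hvt
    obtain ⟨ν, hν, -, hν0, -, hνinvS⟩ := key t ht hvt
    obtain ⟨c, hcA, hsum⟩ := hcoef (a * N' t) (A.mul_mem ha (hN'A t ht))
    refine ⟨fun i => c i * ν⁻¹, fun i => ?_, ?_⟩
    · rw [map_mul, map_inv₀]
      exact S.mul_mem (hAS (hcA i)) hνinvS
    · have hN't0 : N' t ≠ 0 := hN'0 ht0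
      calc s = a * t⁻¹ := hst
        _ = (a * N' t) * (N t)⁻¹ := by
          rw [hNN' t, mul_inv, mul_mul_mul_comm, mul_inv_cancel₀ hN't0, mul_one]
        _ = (∑ i, algebraMap K L (c i) * (b i : L)) * (N t)⁻¹ := by rw [← hsum]
        _ = ∑ i, algebraMap K L (c i * ν⁻¹) * (b i : L) := by
          rw [Finset.sum_mul]
          refine Finset.sum_congr rfl fun i _ => ?_
          rw [map_mul, map_inv₀, hν]
          ring

/-- **The Roots leaf of Lemma 9.4 (HAL p. 29, l. 14–65) from the single remaining node** — the
monomial chart `MonomialChartRegular` (l. 33–49 / 55–59); node N1 is now the theorem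
`invariantRingLocalModel`. [cite: CossartPiltant2008, Lemma 9.4 proof (HAL p. 29, l. 14–65)] -/
theorem tamePrimeDescentViaStableModelRoots_of_monomialChart (h₂ : MonomialChartRegular.{u}) :
    TamePrimeDescentViaStableModelRoots.{u} :=
  tamePrimeDescentViaStableModelRoots_of_nodes invariantRingLocalModel h₂

end Main

/-! ### The directory's dependency statements re-threaded through the one remaining node -/

section Rethreaded

/-- **Lemma 9.4 from Cor. 6.3, Prop. 9.3, the monomial-chart node of HAL p. 29 and (S3\*) for
inertial `W`** (`tamePrimeDescent_of_nodes_of_inertia` with N1 discharged).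
[cite: CossartPiltant2008, Lemma 9.4 (HAL pp. 28–29)] -/
theorem tamePrimeDescent_of_monomialChart_of_inertia (h63 : ClimbToInertiaField.{u})
    (h93 : DescentBelowInertiaField.{u}) (n₂ : MonomialChartRegular.{u})
    (h₂ : GStableUniformizationInertial.{u}) : TamePrimeDescent.{u} :=
  tamePrimeDescent_of_nodes_of_inertia h63 h93 invariantRingLocalModel n₂ h₂

/-- **[CP-I] Thm. 2.1 VERBATIM for reduced quasi-projective threefolds —
`resolutionQuasiProjectiveThreefolds_of_printedLeaves_residuals_nodes` with node N1 discharged.**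
[cite: CossartPiltant2008, Thm 2.1 (HAL p. 3)] [cite: CossartPiltant2009, Theorem (p. 1839)]
[cite: CossartJannsenSaito2020, Introduction Thm. 1, Thm. 1.2] -/
theorem resolutionQuasiProjectiveThreefolds_of_printedLeaves_residuals_monomialChart
    (h49 : RefinedPatchingQuasiProjective.{u}) (hP : CossartPiltant2019Principalization.{u})
    (h83 : PrimeDegreeAscent.{u}) (h93 : DescentBelowInertiaField.{u})
    (n₂ : MonomialChartRegular.{u})
    (hFu : PrimaryTransformRankOne.{u}) (hBPR : BenitoPiltantReguera2022QuadraticSequence.{u})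
    (hnd : GStableUniformizationInertialRankOneNonDiscrete.{u})
    (hdi : GStableUniformizationInertialRankOneDiscreteImperfect.{u})
    (cp2 : CossartPiltant2009Main.{u}) (hE : CossartJannsenSaito2020Embedded.{u})
    (h36 : CossartJannsenSaito2020Sequence.{u}) : ResolutionQuasiProjectiveThreefolds.{u} :=
  resolutionQuasiProjectiveThreefolds_of_printedLeaves_residuals_nodes h49 hP h83 h93
    invariantRingLocalModel n₂ hFu hBPR hnd hdi cp2 hE h36

/-- **Both halves of the 2008 programme's top statement — `cp2008_of_printedLeaves_residuals_nodes`
with node N1 discharged.**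
[cite: CossartPiltant2008, Thm 2.1 and Thm 7.2 (HAL pp. 3–4)] [cite: CossartPiltant2009, Theorem (p. 1839)]
[cite: CossartJannsenSaito2020, Thm. 1.2] -/
theorem cp2008_of_printedLeaves_residuals_monomialChart (p49 : RefinedPatching.{u})
    (hP : CossartPiltant2019Principalization.{u}) (h83 : PrimeDegreeAscent.{u})
    (h93 : DescentBelowInertiaField.{u}) (n₂ : MonomialChartRegular.{u})
    (hFu : PrimaryTransformRankOne.{u})
    (hBPR : BenitoPiltantReguera2022QuadraticSequence.{u})
    (hnd : GStableUniformizationInertialRankOneNonDiscrete.{u})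
    (hdi : GStableUniformizationInertialRankOneDiscreteImperfect.{u})
    (cp2 : CossartPiltant2009Main.{u}) (h36 : CossartJannsenSaito2020General.{u})
    (p41 : CossartJannsenSaito2020Embedded.{u}) :
    ResolutionAffineThreefolds.{u} ∧ LU3DiffFinite.{u} :=
  cp2008_of_printedLeaves_residuals_nodes p49 hP h83 h93 invariantRingLocalModel n₂ hFu hBPR
    hnd hdi cp2 h36 p41

/-- **[CP-I] Thm. 2.1 VERBATIM, universe `0`, core residual (Knaf–Kuhlmann 2009) —
`resolutionQuasiProjectiveThreefolds_of_printedLeaves_residuals₀_nodes` with node N1 discharged.**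
[cite: CossartPiltant2008, Thm 2.1 (HAL p. 3)] [cite: KnafKuhlmann2009, Thm. 1.5]
[cite: CossartJannsenSaito2020, Introduction Thm. 1, Thm. 1.2] -/
theorem resolutionQuasiProjectiveThreefolds_of_printedLeaves_residuals₀_monomialChart
    (h49 : RefinedPatchingQuasiProjective.{0}) (hP : CossartPiltant2019Principalization.{0})
    (h83 : PrimeDegreeAscent.{0}) (h93 : DescentBelowInertiaField.{0})
    (n₂ : MonomialChartRegular.{0})
    (hFu : PrimaryTransformRankOne.{0}) (hKK : KnafKuhlmann2009MonogenicCompletion)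
    (hBPR : BenitoPiltantReguera2022QuadraticSequence.{0})
    (hnd : GStableUniformizationInertialRankOneNonDiscrete.{0})
    (hdic : GStableUniformizationInertialRankOneDiscreteImperfectCore)
    (cp2 : CossartPiltant2009Main.{0}) (hE : CossartJannsenSaito2020Embedded.{0})
    (h36 : CossartJannsenSaito2020Sequence.{0}) : ResolutionQuasiProjectiveThreefolds.{0} :=
  resolutionQuasiProjectiveThreefolds_of_printedLeaves_residuals₀_nodes h49 hP h83 h93
    invariantRingLocalModel n₂ hFu hKK hBPR hnd hdic cp2 hE h36

end Rethreaded

end Literature.AlgebraicGeometry.CossartPiltant200819.CP2008
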